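import Summits.ValiantsHypothesis.ValiantsHypothesis.Theorems.BarrierLeverChowBenchmarkPairsBlockPeel
import Summits.ValiantsHypothesis.ValiantsHypothesis.Theorems.BarrierLeverChowBenchmarkPairsDirichletSplit

/-!
# Route BarrierLever — item 22038 `ChowBenchmarkPairs`, line `moore-peel`: TYPED NODE «CONJECTURE B3» (every
# triple block of the segment peel is nonsingular) and its KERNEL ARROW to node #1 through the block peel theorem

Helper file (`--supports stmt-ValiantsHypothesis-22038`; cell valiant-natproofs, rung V4, 𝒟-side benchmark of
record, line `moore_peel`, planner kernel target **K3** (HOME/STATUS.md l.1746: «Conjecture P / B3 as typed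
by-name nodes with their arrow to #1 via K1»); seat val-np-p4 gen 29).  Closes NO item.  One definition
(`Stmt.conjB3`, a `Prop`), BY NAME — not a registered stub (R30: block-peel statements are STRONGER devices than
node #1 and enter by name with their arrow).

THE NODE.  Memo `HOME/val-np-p4/g28/memo/MEMO-valnp4-g28.md` §4, CONJECTURE B3: for every `i ≥ 0` the tied
TRIPLE block `{i+1, i+2, i+3}` of the hierarchical Moore peel with segment weights is nonsingular, i.e. (Lean
indexing of `…BlockPeelRows`: stage `i` carries `T_j`, `j < i`, so the memo's `J(i,3)` is `blockMatrix (i+1) 3`)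
`det J^{!}(i,3)(Λ_0,Λ_1,Λ_2) ≠ 0` in `ℤ[Λ]` for every `i ≥ 1`.  EVIDENCE (kit j324405, memo §3.1): NO singular
triple for `i < 2 000` (exhaustive, random ratios mod `2³¹-1`: nonzero mod p ⇒ nonzero in `ℤ[Λ]`), none among the
110 triples around the bad stages `≤ 8 000`, none near the runs `≤ 20 069`.  WHY IT MIGHT FAIL: the singular DOUBLE
blocks `{b, b+1}` at bad `b` (444, 726, 892, …) are torus-equivariant cancellations invisible to Hall-type
counting (memo §3.3); nothing known forbids a three-point cancellation at some large `i`.  REFUTER TARGET: one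
`i` with `det J^{!}(i,3) = 0` at two random points mod two primes.

THE ARROW (kernel, this file): `Stmt.conjB3 → ∀ h, KernelPoisedAt Nat.factorial h` — tile `[1, h]` by the
`h % 3` leading singles `{1}`, `{2}` (good stages: `det G_1, det G_2 ≠ 0`, THEOREM W's window) followed by
`h / 3` consecutive triples, and apply `kernelPoisedAt_of_blocks` (`…BlockPeel`); the conclusion
`segmentMeanValue_of_conjB3` is the line file's node #1 `∀ h, SegmentMeanValueAt h` VERBATIM.

WHAT THIS IS NOT: `Stmt.conjB3` is OPEN (numerically supported, not proved); node #1 is not closed; nothing on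
crux stmt-ValiantsHypothesis-14610 or on `VP` versus `VNP`.
-/

set_option linter.dupNamespace false

namespace Summit.ValiantsHypothesis.ValiantsHypothesis.Theorems.BarrierLever.MoorePeel

open Polynomial Finset

/-- **CONJECTURE B3** (memo g28 §4, typed): every tied triple block of the segment-weighted hierarchical Moore
peel has nonzero symbolic block determinant — `det J^{!}(i,3)(Λ) ≠ 0` in `ℤ[Λ_0, Λ_1, Λ_2]` for every stage
`i ≥ 1` (`blockMatrix` of `…BlockPeelRows`; the memo's `J(i-1, 3)`). -/
def Stmt.conjB3 : Prop :=
  ∀ i : ℕ, 1 ≤ i →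
    (blockMatrix Nat.factorial i 3 (fun s : Fin 3 => (MvPolynomial.X s : MvPolynomial (Fin 3) ℤ))).det ≠ 0

/-- Transport of a block hypothesis along an equality of block lengths. -/
theorem det_blockMatrix_X_ne_zero_of_eq (κ : ℕ → ℕ) (i : ℕ) {t t' : ℕ} (e : t = t')
    (h : (blockMatrix κ i t' (fun s : Fin t' => (MvPolynomial.X s : MvPolynomial (Fin t') ℤ))).det ≠ 0) :
    (blockMatrix κ i t (fun s : Fin t => (MvPolynomial.X s : MvPolynomial (Fin t) ℤ))).det ≠ 0 := by
  subst e
  exact h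

/-- The two leading singles: `det J^{!}(i,1) ≠ 0` for `i ∈ {1, 2}` (indeed for every good stage `i ≤ 182`),
from THEOREM W's certified window and `det_blockMatrix_one_X_ne_zero_iff`. -/
theorem det_blockMatrix_factorial_one_ne_zero_of_le_182 (i : ℕ) (h1 : 1 ≤ i) (hi : i ≤ 182) :
    (blockMatrix Nat.factorial i 1 (fun s : Fin 1 => (MvPolynomial.X s : MvPolynomial (Fin 1) ℤ))).det ≠ 0 := by
  rw [det_blockMatrix_one_X_ne_zero_iff, kpeelMatrix_factorial]
  exact det_peelMatrix_ne_zero_of_le_182_by_W i hi h1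

/-- **THE ARROW `B3 ⇒ node #1`** (kernel poisedness form): under CONJECTURE B3, `KernelPoisedAt k! h` for EVERY
`h` — tile `[1, h]` by `h % 3` leading singles and `h / 3` triples and apply the block peel theorem. -/
theorem kernelPoisedAt_factorial_of_conjB3 (hB3 : Stmt.conjB3) (h : ℕ) : KernelPoisedAt Nat.factorial h := by
  -- cut points: `a q = 1 + q` for `q ≤ h % 3`, then steps of `3`
  set s₀ := h % 3 with hs₀
  set a : ℕ → ℕ := fun q => if q ≤ s₀ then 1 + q else 1 + s₀ + 3 * (q - s₀) with ha
  have hs₀lt : s₀ < 3 := Nat.mod_lt h (by norm_num)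
  have hdecomp : 3 * (h / 3) + s₀ = h := Nat.div_add_mod h 3
  refine kernelPoisedAt_of_blocks Nat.factorial (fun k => Nat.factorial_ne_zero k) h (s₀ + h / 3) a
    (by simp [ha]) ?_ ?_ ?_
  · -- `a (s₀ + h/3) = h + 1`
    simp only [ha]
    split_ifs with hle
    · have : h / 3 = 0 := by omega
      omega
    · omega
  · -- strictly increasing
    intro q hq
    simp only [ha]
    split_ifs <;> omega
  · -- every block is a single at a stage `≤ 2` or a triple
    intro q hq
    by_cases hqs : q < s₀
    · have e1 : a (q + 1) - a q = 1 := by simp only [ha]; split_ifs <;> omega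
      have e2 : a q = 1 + q := by simp only [ha]; rw [if_pos (le_of_lt hqs)]
      rw [e2] at e1 ⊢
      exact det_blockMatrix_X_ne_zero_of_eq Nat.factorial (1 + q) e1
        (det_blockMatrix_factorial_one_ne_zero_of_le_182 (1 + q) (by omega) (by omega))
    · have e1 : a (q + 1) - a q = 3 := by simp only [ha]; split_ifs <;> omega
      exact det_blockMatrix_X_ne_zero_of_eq Nat.factorial (a q) e1
        (hB3 (a q) (by simp only [ha]; split_ifs <;> omega))

/-- **THE ARROW `B3 ⇒ node #1`**, verbatim: under CONJECTURE B3 the line file's `SegmentMeanValueAt h` holds for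
EVERY `h`, i.e. the registered node #1 `stub_segmentMeanValue` (`∀ h, SegmentMeanValueAt h`) follows. -/
theorem segmentMeanValue_of_conjB3 (hB3 : Stmt.conjB3) (h : ℕ) :
    ∀ (r : ℕ) (u : Fin r → Finset (Fin h)), Function.Injective u → (∀ i, (u i).card ≤ 2) →
      (∀ S : Finset (Fin h), S.card ≤ 2 → ∃ i, u i = S) →
      ∃ P : Fin h → Fin h → ℂ,
        (Matrix.of fun i j : Fin r =>
          ∑ g : (↥(benchCols h r j) → ↥(u i)), (∏ c : ↥(benchCols h r j), P (g c) c) *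
            ∏ a : ↥(u i),
              ((Finset.univ.filter fun c : ↥(benchCols h r j) => g c = a).card.factorial : ℂ)).det ≠ 0 :=
  kernelPoisedAt_factorial_of_conjB3 hB3 h

end Summit.ValiantsHypothesis.ValiantsHypothesis.Theorems.BarrierLever.MoorePeel
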